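import Mathlib
import HarnessLib
import Literature.Geometry.DiscreteGeometry.SphericalCodeHullEulerFormula
import Summits.AtomisticToContinuum.Crystallization.Theorems.PricedLinkCensusSoftFourRingsHullBridge
import Summits.AtomisticToContinuum.Crystallization.Theorems.PricedLinkCensusSoftFourRingsCapInterior
import Summits.AtomisticToContinuum.Crystallization.Theorems.PricedLinkCensusSoftFourRingsBondFacet
import Summits.AtomisticToContinuum.Crystallization.Theorems.PricedLinkCensusSoftFourRingsCapFanGap
import Summits.AtomisticToContinuum.Crystallization.Theorems.PricedLinkCensusSoftFourRingsExtraEdge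

/-!
# Soft four-rings: a three-fan vertex carries an extra hull edge

Support file for `SoftFourRings` (route `PricedLinkCensus`, sub-problem `Crystallization`).

Combinatorics of the hull complex of the twelve unit directions (`hullEdges`, `facetNormals`,
`facetsOfEdge` of `Literature.Geometry.DiscreteGeometry`):

* `exists_facet_ne_of_mem_hullEdges` — through a hull edge there is a facet different from any
  given one (every hull edge lies in exactly two facets);
* `exists_consecutive_neighbour` — inside a facet through the hull edge `{v, u}` the vertex `v` has
  a second facet-neighbour `y ≠ u` with `{v, y}` again a hull edge;
* `exists_extra_hullEdge_of_three_fan_one_percent` — **rule R1** of the classification: if `v` is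
  bonded to `w 0, …, w 3` and `w 0 ∼ w 1 ∼ w 2 ∼ w 3` are bonded (three bond triangles at `v`),
  then `v` has a hull edge to a point `y ∉ {v, w 0, …, w 3}` (conditional on Tammes-13, through the
  corner cap `no_facet_through_three_fan_one_percent`).

**`Cap` variant** (seat c3 of stmt-AtomisticToContinuum-14234): identical to `PricedLinkCensusSoftFourRingsExtraEdge`, except that the
global Tammes-13 hypothesis `(hT : musinTarasov2012_tammes_thirteen)` is replaced by the LOCAL covering
property of the twelve directions, `hT : ∀ p, ‖p‖ = 1 → ∃ x ∈ X, dist p x < 0.957` (no empty cap of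
angular radius `57.18°`), which is all the two roots (`FacetCap`, `Interior`) ever used; the hT-free
lemmas are not repeated (the original file is imported for them).
-/

namespace Summit.AtomisticToContinuum.Crystallization.Theorems.Cap

open Real RealInnerProductSpace Literature.Geometry.DiscreteGeometry

/-- **Rule R1: a three-fan vertex carries an extra hull edge** (conditional on Tammes-13).
Among `≥ 12` unit vectors with pairwise inner products `≤ 1 − 1/(2·1.01²)`, let `v` be bonded
(`⟪·,·⟫ ≥ 1 − 1.01²/2`) to `w 0, …, w 3` with `w 0 ∼ w 1 ∼ w 2 ∼ w 3` bonded.  Then some hull edge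
at `v` ends outside `{v, w 0, …, w 3}`.  Proof: the bond `{v, w 0}` is a hull edge lying in the
bond-triangle facet `{v, w 0, w 1}` and in a second facet `c'`; the other facet-neighbour `y` of
`v` in `c'` is neither `w 1` nor `w 2` (the hull edges `{v, w 1}`, `{v, w 2}` already lie in two
bond triangles each) nor `w 3` (no facet contains `v, w 0, w 3`, by the corner cap). -/
theorem exists_extra_hullEdge_of_three_fan_one_percent {X : Finset (EuclideanSpace ℝ (Fin 3))}
    (hT : ∀ p : EuclideanSpace ℝ (Fin 3), ‖p‖ = 1 → ∃ x ∈ X, dist p x < 0.957)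
    (hX1 : ∀ y ∈ X, ‖y‖ = 1) (hcard : 12 ≤ X.card)
    (hsepX : ∀ u ∈ X, ∀ u' ∈ X, u ≠ u' → ⟪u, u'⟫ ≤ 1 - 1 / (2 * (101 / 100 : ℝ) ^ 2))
    {v : (EuclideanSpace ℝ (Fin 3))} (hv : v ∈ X) (w : Fin 4 → (EuclideanSpace ℝ (Fin 3))) (hwX : ∀ k, w k ∈ X) (hwinj : Function.Injective w)
    (hwv : ∀ k, w k ≠ v) (hvw : ∀ k, 1 - (101 / 100 : ℝ) ^ 2 / 2 ≤ ⟪v, w k⟫)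
    (h01 : 1 - (101 / 100 : ℝ) ^ 2 / 2 ≤ ⟪w 0, w 1⟫)
    (h12 : 1 - (101 / 100 : ℝ) ^ 2 / 2 ≤ ⟪w 1, w 2⟫)
    (h23 : 1 - (101 / 100 : ℝ) ^ 2 / 2 ≤ ⟪w 2, w 3⟫) :
    ∃ y ∈ X, y ≠ v ∧ (∀ k, y ≠ w k) ∧ ({v, y} : Finset (EuclideanSpace ℝ (Fin 3))) ∈ hullEdges X := by
  classical
  have h0 : (0 : (EuclideanSpace ℝ (Fin 3))) ∈ interior (convexHull ℝ (X : Set (EuclideanSpace ℝ (Fin 3)))) :=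
    zero_mem_interior_convexHull_of_twelve_le_card hT hX1 hcard (ca := 1 - 1 / (2 * (101 / 100 : ℝ) ^ 2))
      (by norm_num) hsepX
  have hw01 : w 0 ≠ w 1 := fun h => by simpa using hwinj h
  have hw12 : w 1 ≠ w 2 := fun h => by simpa using hwinj h
  have hw23 : w 2 ≠ w 3 := fun h => by simpa using hwinj h
  have hw02 : w 0 ≠ w 2 := fun h => by simpa using hwinj h
  have hw13 : w 1 ≠ w 3 := fun h => by simpa using hwinj h
  have hw03 : w 0 ≠ w 3 := fun h => by simpa using hwinj h
  -- the three bond-triangle facets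
  obtain ⟨c₀, hc₀F, hc₀T, -, -⟩ := bond_triangle_facet_one_percent hX1 hsepX hv (hwX 0) (hwX 1)
    (hwv 0).symm (hwv 1).symm hw01 (hvw 0) (hvw 1) h01
  obtain ⟨c₁, hc₁F, hc₁T, -, -⟩ := bond_triangle_facet_one_percent hX1 hsepX hv (hwX 1) (hwX 2)
    (hwv 1).symm (hwv 2).symm hw12 (hvw 1) (hvw 2) h12
  obtain ⟨c₂, hc₂F, hc₂T, -, -⟩ := bond_triangle_facet_one_percent hX1 hsepX hv (hwX 2) (hwX 3)
    (hwv 2).symm (hwv 3).symm hw23 (hvw 2) (hvw 3) h23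
  -- membership facts in the explicit tight sets
  have mem3 : ∀ {a b d x : (EuclideanSpace ℝ (Fin 3))}, x ∈ ({a, b, d} : Finset (EuclideanSpace ℝ (Fin 3))) ↔ x = a ∨ x = b ∨ x = d := by
    intro a b d x
    rw [Finset.mem_insert, Finset.mem_insert, Finset.mem_singleton]
  have hc01 : c₀ ≠ c₁ := by
    intro h
    have : w 0 ∈ tightSet X c₁ := by rw [← h, hc₀T, mem3]; exact Or.inr (Or.inl rfl)
    rw [hc₁T, mem3] at this
    rcases this with h | h | h
    exacts [hwv 0 h, hw01 h, hw02 h]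
  have hc12 : c₁ ≠ c₂ := by
    intro h
    have : w 1 ∈ tightSet X c₂ := by rw [← h, hc₁T, mem3]; exact Or.inr (Or.inl rfl)
    rw [hc₂T, mem3] at this
    rcases this with h | h | h
    exacts [hwv 1 h, hw12 h, hw13 h]
  -- the bond `{v, w 0}` is a hull edge, in `c₀` and in a second facet `c'`
  have hE0 : ({v, w 0} : Finset (EuclideanSpace ℝ (Fin 3))) ∈ hullEdges X :=
    pair_mem_hullEdges_of_soft_bond_one_percent hX1 hsepX hv (hwX 0) (hwv 0).symm (hvw 0)
  obtain ⟨c', hc'F, hc'0, hc'T⟩ := exists_facet_ne_of_mem_hullEdges hX1 h0 hE0 c₀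
  have hvc' : v ∈ tightSet X c' := hc'T (Finset.mem_insert_self _ _)
  have hw0c' : w 0 ∈ tightSet X c' := hc'T (Finset.mem_insert_of_mem (Finset.mem_singleton_self _))
  -- `c'` is none of the bond triangles (it contains `w 0` and differs from `c₀`)
  have hc'1 : c' ≠ c₁ := by
    intro h
    have := hw0c'
    rw [h, hc₁T, mem3] at this
    rcases this with h | h | h
    exacts [hwv 0 h, hw01 h, hw02 h]
  have hc'2 : c' ≠ c₂ := by
    intro h
    have := hw0c'
    rw [h, hc₂T, mem3] at this
    rcases this with h | h | h
    exacts [hwv 0 h, hw02 h, hw03 h]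
  -- the other neighbour of `v` along `c'`
  obtain ⟨y, hyc', hyv, hy0, hEy⟩ := exists_consecutive_neighbour hX1 h0 hc'F (hwv 0).symm hE0 hc'T
  have hyX : y ∈ X := tightSet_subset X c' hyc'
  have hvy : ({v, y} : Finset (EuclideanSpace ℝ (Fin 3))) ⊆ tightSet X c' := by
    intro x hx
    rw [Finset.mem_insert, Finset.mem_singleton] at hx
    rcases hx with rfl | rfl
    exacts [hvc', hyc']
  refine ⟨y, hyX, hyv, ?_, hEy⟩
  intro k
  fin_cases k
  · exact hy0
  · -- `y = w 1`: the hull edge `{v, w 1}` would lie in `c₀`, `c₁` and `c'`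
    show y ≠ w 1
    intro h
    rw [h] at hEy hvy
    refine false_of_three_facetsOfEdge hX1 h0 hEy hc₀F hc₁F hc'F ?_ ?_ hvy hc01 hc'0.symm hc'1.symm
    · rw [hc₀T]; intro x hx
      rw [Finset.mem_insert, Finset.mem_singleton] at hx
      rw [mem3]; rcases hx with rfl | rfl
      exacts [Or.inl rfl, Or.inr (Or.inr rfl)]
    · rw [hc₁T]; intro x hx
      rw [Finset.mem_insert, Finset.mem_singleton] at hx
      rw [mem3]; rcases hx with rfl | rfl
      exacts [Or.inl rfl, Or.inr (Or.inl rfl)]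
  · -- `y = w 2`: the hull edge `{v, w 2}` would lie in `c₁`, `c₂` and `c'`
    show y ≠ w 2
    intro h
    rw [h] at hEy hvy
    refine false_of_three_facetsOfEdge hX1 h0 hEy hc₁F hc₂F hc'F ?_ ?_ hvy hc12 hc'1.symm hc'2.symm
    · rw [hc₁T]; intro x hx
      rw [Finset.mem_insert, Finset.mem_singleton] at hx
      rw [mem3]; rcases hx with rfl | rfl
      exacts [Or.inl rfl, Or.inr (Or.inr rfl)]
    · rw [hc₂T]; intro x hx
      rw [Finset.mem_insert, Finset.mem_singleton] at hx
      rw [mem3]; rcases hx with rfl | rfl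
      exacts [Or.inl rfl, Or.inr (Or.inl rfl)]
  · -- `y = w 3`: the facet `c'` would contain `v`, `w 0`, `w 3`
    show y ≠ w 3
    intro h
    rw [h] at hyc'
    exact no_facet_through_three_fan_one_percent hT hX1 hcard hsepX hv w hwX hwinj hwv hvw h01 h12
      h23 (mem_facetNormals.1 hc'F).1 (mem_tightSet.1 hvc').2 (mem_tightSet.1 hw0c').2
      (mem_tightSet.1 hyc').2

end Summit.AtomisticToContinuum.Crystallization.Theorems.Cap
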